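import Summits.Schanuel.Schanuel.Theorems.RootDecomp1KLevelFinite01

/-!
# RootDecomp1KLevelFinite — lens 1, generation 51, node 10 «LEVEL FINITENESS: the thin-fibre residual ThinFibre m₀ (ALL P ≠ 0, EVERY m₀ ≥ 2) GRADED BY SIEGEL'S EXCEPTIONAL CLASSES» — continuation (RootDecomp1KLevelFinite02): §2 the Siegel–Mahler trichotomy typed to consumption shape + §3 the one-pole shape (proved)

(lens-1 g51 HOME kernel K = HOME/decomp-schanuel-lens-1/g51/LevelFinite.lean b1fbaeff…, 843 l, ONE import …RootDecomp1KXLinear05 BY NAME; P LevelFiniteProbe.lean 6077dbab… rc 0 / C₀ LevelFiniteCtrl0.lean 388c6d35… rc 0 / C LevelFiniteCtrl.lean 6b696b71… rc 1 = 16 planted; memo NODE-g51.md ed9ba755…; CLAIM L2477, EX-ANTE PRICE + CHECKLIST K-g51 L2478, NODE L2479 / REQUEST L2480, writer re-check L2481, critic VERDICT L2482: CLEARED AS PRICED EX ANTE — ONE THEOREM ×1 «LEVEL-FINITENESS REDUCTION», RULE K-R40, PORT GO. Port by census-1 gen 21 as `RootDecomp1KLevelFinite01–04` along K's §0–§7: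 01 = §0 the truncations `sQ` + §1 `LevelFinite` (def) and the PROVED glue `thinFibre_of_levelFinite` / (b); 02 = §2 the Siegel–Mahler trichotomy typed to consumption shape (`IsDyadic`, `NormShapeHyp`, `SiegelShapes` [requested Literature fact, cite item wi-102309], `LaurentShapeLF`, `TwoAdicBounded`, `NormShapeLFNonsplit`, `NormShapeLFSplitImag` [hypothesis, ATTACKABLE], `NormShapeLFSplitReal` [hypothesis, FACT-NEEDED, cite item wi-102310], `NormShapeLevels`) + §3 the one-pole shape PROVED from the tree's `levels_finite` (Ridout by tree name); 03 = §4 the assembly `levelFinite_of_siegelShapes` / `thinFibre_of_siegelShapes` / `b_of_siegelShapes` + §5 the two-rational-poles shape PROVED hyp-free (`laurentShapeLF_holds`); 04 = §6 headline corollaries + §7 the non-split conjugate-poles grade PROVED (`normShapeLFNonsplit_holds`) and the primed headline corollaries. PORT EDITS (census convention, pre-sanctioned L2482): `isCoprime_num_den` PRIVATISED (verbatim twin of `Literature.NumberTheory.DiophantineApproximation.SparseDyadicRationals.isCoprime_num_den`, writer flag (α)); `padicValInt_two_pow` (v₂(xⁿ) = n·v₂(x)) privatised + documented (generic one-liner;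 a DIFFERENT statement under the same short name is private in CollarCell01 / CollarWall01); docstrings added on `thinFibre_of_siegelShapes'` / `b_of_siegelShapes'`; the two «[cite …]» brackets inside the docstrings of the HYPOTHESIS defs `SiegelShapes` / `NormShapeLFSplitReal` re-punctuated to «(sources: …)» so that the gate does not RELOCATE these consumption-shape hypothesis statements into Literature/Uncategorized (first filing p841087 was relocated and bounced there: an inline-cited `def … : Prop` is treated as a Literature fact; these are NOT verbatim print — cite-kind items wi-102309 / wi-102310 track the facts), text otherwise unchanged; per-part private copies if any; K carries no `set_option` (its 52 dupNamespace lint warnings are HOME-path artefacts, 0 in the tree build); statements and proofs otherwise verbatim, no renames, no heartbeat lines. `--supports stmt-Schanuel-33364`; no census credit carried; rung 0 — nothing here proves Schanuel, 33364, 31077, 33363, ThinFibre m₀ or the (b)-cell hypothesis-free.)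
-/

noncomputable section

open Polynomial LiouvilleNumber
open scoped Nat

namespace Summit.Schanuel.Schanuel.Theorems.RootDecomp1KLevelFinite

open Summit.Schanuel.Schanuel.Theorems.RootDecomp1KSkelCell (iota SkelLiouville SkelLiouvilleFix
  skelLiouville_iff_fix SkelLiouvilleFix.mono)
open Summit.Schanuel.Schanuel.Theorems.RootDecomp1KTwoBaseCell (psNumer partialSum_eq_psNumer_div coprime_psNumer
  sb_of_range_eq')
open Summit.Schanuel.Schanuel.Theorems.RootDecomp1KRelLiouvilleCell (partialSum_two_strictMono)
open Summit.Schanuel.Schanuel.Theorems.RootDecomp1KDegreeLadder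
open Summit.Schanuel.Schanuel.Theorems.RootDecomp1KXLinear (xLinP bev_xLinP aeval_ratCast levels_finite
  thinFibreAt_mul_left)
open Summit.Schanuel.Schanuel.Theorems.RootDecomp1KHyper (SB SFset sb_of_algebraicIndependent)

/-! ## §2  The SIEGEL–MAHLER TRICHOTOMY typed to consumption shape, and the exceptional-shape pieces (TYPED) -/

/-- [auxiliary predicate] dyadic rationals `ℤ[1/2]` — the `{2,∞}`-integers of `ℚ` (denominator a power of two). -/
def IsDyadic (x : ℚ) : Prop := ∃ k : ℕ, x.den = 2 ^ k

/-- The denominator of `sQ N` divides `2^{N!}`. -/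
theorem sQ_den_dvd (N : ℕ) : (sQ N).den ∣ 2 ^ N ! := by
  have h := Rat.den_dvd (psNumer 2 N : ℤ) ((2 : ℤ) ^ N !)
  rw [Rat.divInt_eq_div] at h
  have e : ((psNumer 2 N : ℤ) : ℚ) / (((2 : ℤ) ^ N ! : ℤ) : ℚ) = sQ N := by simp [sQ]
  rw [e] at h
  exact_mod_cast h

/-- The truncations `sQ N` are dyadic. -/
theorem isDyadic_sQ (N : ℕ) : IsDyadic (sQ N) := by
  obtain ⟨k, -, hk⟩ := (Nat.dvd_prime_pow Nat.prime_two).1 (sQ_den_dvd N)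
  exact ⟨k, hk⟩

/-- `0 ≤ sQ N ≤ 2`. -/
theorem abs_sQ_le (N : ℕ) : |sQ N| ≤ 2 := by
  have h1 : (psNumer 2 N : ℚ) < 2 * 2 ^ N ! := by exact_mod_cast psNumer_lt N
  have h0 : (0 : ℚ) ≤ psNumer 2 N := by positivity
  have hpow : (0 : ℚ) < 2 ^ N ! := by positivity
  rw [sQ, abs_of_nonneg (by positivity)]
  rw [div_le_iff₀ hpow]
  linarith

/-- [auxiliary predicate] the side conditions of the CONJUGATE-POLES shape: `q` an irreducible integer quadratic
(no rational root), `g` coprime to `q`, pole order `a ≥ 1`, `deg g ≤ 2a`, scaling `D ≠ 0` (definition with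
parameters, not a fact). -/
def NormShapeHyp (g q : ℤ[X]) (a : ℕ) (D : ℤ) : Prop :=
  q.natDegree = 2 ∧ (∀ t : ℚ, aeval t q ≠ 0) ∧ (∀ z : ℂ, aeval z q = 0 → aeval z g ≠ 0) ∧
    1 ≤ a ∧ g.natDegree ≤ 2 * a ∧ D ≠ 0

/-- [auxiliary] the level set of the conjugate-poles shape `x = g(t)/(D·q(t)^a)`:
the levels `N` with `g(t) = D·s_N·q(t)^a` for some `t ∈ ℚ`. -/
def NormShapeLevels (g q : ℤ[X]) (a : ℕ) (D : ℤ) : Set ℕ :=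
  {N | ∃ t : ℚ, aeval t g = D * sQ N * (aeval t q) ^ a}

/-- [hypothesis] definition — INPUT, FACT-corollary, INFRASTRUCTURE-NEEDED; NOT in the tree, NOT verbatim print
(sources: Lang1983 Ch. 8 Thm 2.4 (p.160) + Thm 5.1 (pp.164–165); BombieriGubler2006 Thm 7.3.9 + Rem 7.3.10 (pp.178–179);
Alvanos–Bilu–Poulakis 2009 Thm 1.1 (arXiv:0907.2097); cite-kind ledger item wi-102309); typed by lens-1 g51 to consumption shape
(derivation NODE-g51.md §4): **THE SIEGEL–MAHLER TRICHOTOMY FOR PRIME PLANE CURVES OVER `ℚ`, `S = {2, ∞}`.**  For a prime `P ∈ ℤ[x][Y]` of `Y`-degree `≥ 2` (so `C : P = 0` is a `ℚ`-irreducible affine plane curve),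
EITHER (A) only finitely many dyadic rationals `x ∈ ℤ[1/2]` are `x`-coordinates of rational points of `C`, OR the
smooth projective model `C̃` is `ℙ¹_ℚ` with `x` having at most two poles on it and, choosing the coordinate `t` on `ℙ¹_ℚ`
adapted to the poles, every rational point of `C` outside a finite set of `x`-coordinates has `x = F(t)` for some rational
`t` with: (B1) ONE pole — `F = f/D`, `f ∈ ℤ[t]`, `deg f ≥ 2`; (B2a) TWO RATIONAL poles — `F = g(t)/(D·t^a)`, `g(0) ≠ 0`,
`1 ≤ a < deg g`, `t ≠ 0`; (B2b) TWO CONJUGATE poles — `F = g(t)/(D·q(t)^a)` with `NormShapeHyp g q a D`.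
WHY IT IS A THEOREM (informal; sources): rational points `(x, r)` with `x ∈ ℤ[1/2]` are exactly the `ℤ[1/2]`-integral
points of the monicised model `z = a(x)·Y` (`ℤ[1/2]` integrally closed), whose points at infinity are the poles of `x`;
by SIEGEL's theorem on integral points as extended to `S`-integers by MAHLER and LANG [Siegel 1929; Mahler 1934; Lang,
*Fundamentals of Diophantine Geometry* Ch. 8 Thm 2.4; Bombieri–Gubler, *Heights* Thm 7.3.9] an affine curve with
infinitely many `S`-integral points has genus `0` and at most two points at infinity; such a curve with a rational point
is `ℙ¹_ℚ` minus `≤ 2` points (LÜROTH), and a rational function on `ℙ¹_ℚ` with pole divisor supported on one rational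
point / two rational points / a conjugate pair is, after a `ℚ`-Möbius change of `t`, of shape (B1) / (B2a) / (B2b);
`deg F = deg_Y P ≥ 2` excludes `deg f = 1`.  REQUESTED as a Literature fact (cite-kind item wi-102309, NODE-g51.md §6).
NOT PROVED HERE; consumed BY NAME as the binder `(hS : SiegelShapes)`.  «prime» is Mathlib's `Prime` in the UFD
`ℤ[X][X]` (`Polynomial.instUniqueFactorizationMonoid` over `ℤ[X]`). -/
def SiegelShapes : Prop :=
  ∀ P : ℤ[X][X], Prime P → 2 ≤ P.natDegree →
    (Set.Finite {x : ℚ | IsDyadic x ∧ ∃ r : ℚ, bev P x r = 0}) ∨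
    (∃ (f : ℤ[X]) (D : ℤ) (E : Finset ℚ), 2 ≤ f.natDegree ∧ D ≠ 0 ∧
        ∀ x r : ℚ, bev P x r = 0 → x ∈ E ∨ ∃ t : ℚ, aeval t f = D * x) ∨
    (∃ (g : ℤ[X]) (a : ℕ) (D : ℤ) (E : Finset ℚ), 1 ≤ a ∧ a < g.natDegree ∧ g.coeff 0 ≠ 0 ∧ D ≠ 0 ∧
        ∀ x r : ℚ, bev P x r = 0 → x ∈ E ∨ ∃ t : ℚ, t ≠ 0 ∧ aeval t g = D * x * t ^ a) ∨
    (∃ (g q : ℤ[X]) (a : ℕ) (D : ℤ) (E : Finset ℚ), NormShapeHyp g q a D ∧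
        ∀ x r : ℚ, bev P x r = 0 → x ∈ E ∨ ∃ t : ℚ, aeval t g = D * x * (aeval t q) ^ a)

/-- [statement def — PROVED below (`laurentShapeLF_holds`, §5); census convention] **THE
TWO-RATIONAL-POLES SHAPE.**  For `g ∈ ℤ[t]` with `g(0) ≠ 0`, `1 ≤ a < deg g`, `D ≠ 0`: only finitely many truncations
satisfy `g(t) = D·s_N·t^a` with `t ∈ ℚ^×`.  Paper proof (NODE-g51.md §3.2): writing `t = u/v` in lowest terms, `u^a`
and `v^{deg g − a}` divide `2^{N!}·v^{deg g} g(u/v)` whence the odd parts of `u`, `v` divide `g(0)`, `lc g` — so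
`t = ±λ·2^e` with `λ` in a finite set —, and `|g(t)/t^a| → ∞` both as `t → 0` and as `|t| → ∞` while `s_N ∈ [1/2, 3/2]`,
so `e` is bounded; each of the finitely many `t` fixes `x = s_N`, hence `N` (`sQ_injective`). -/
def LaurentShapeLF : Prop :=
  ∀ (g : ℤ[X]) (a : ℕ) (D : ℤ), 1 ≤ a → a < g.natDegree → g.coeff 0 ≠ 0 → D ≠ 0 →
    {N : ℕ | ∃ t : ℚ, t ≠ 0 ∧ aeval t g = D * sQ N * t ^ a}.Finite

/-- [auxiliary predicate] the arithmetic side condition «`2` does NOT split for `q`», typed over `ℤ` by primitive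
representations: the binary form `Q(u,v) = q₂u² + q₁uv + q₀v²` of `q` does not primitively represent multiples of
arbitrarily high powers of `2`.  For an irreducible integer quadratic `q` (`q₂q₀ ≠ 0`) this is EQUIVALENT to «`q` has no
root in `ℚ₂`» (⟸ Hensel/compactness of `ℙ¹(ℤ₂)`; ⟹ approximate a `2`-adic root), i.e. to «`2` is inert or ramified in
`ℚ(√disc q)`», i.e. to «`disc q / 4^k ≢ 1 (mod 8)` for the `k` with `4^k ∥ disc q`» (NODE-g51.md §3.3); it is consumed
below exactly in this primitive-representation form. -/
def TwoAdicBounded (q : ℤ[X]) : Prop :=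
  ∃ B : ℕ, ∀ u v : ℤ, IsCoprime u v →
    ¬ ((2 : ℤ) ^ B ∣ q.coeff 2 * u ^ 2 + q.coeff 1 * u * v + q.coeff 0 * v ^ 2)

/-- [statement def — PROVED below (`normShapeLFNonsplit_holds`, §7); census convention] **CONJUGATE POLES, `2` NOT
SPLIT** (`TwoAdicBounded q`: `q` has no root in `ℚ₂`, i.e. `2` inert or ramified in `ℚ(√disc q)`).  Proof (§7 and
NODE-g51.md §3.3): clearing denominators in `g(t) = D·s_N·q(t)^a`, `t = u/v`, gives the INTEGER identity
`2^{N!}·G(u,v) = D·p_N·Q(u,v)^a` with `p_N = psNumer 2 N` odd; hence `N! ≤ v₂(D) + a·v₂(Q(u,v)) < v₂(D) + a·B`. -/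
def NormShapeLFNonsplit : Prop :=
  ∀ (g q : ℤ[X]) (a : ℕ) (D : ℤ), NormShapeHyp g q a D → TwoAdicBounded q →
    (NormShapeLevels g q a D).Finite

/-- [hypothesis] definition — residual class, ATTACKABLE (elementary algebraic number theory of an imaginary quadratic
field + lifting-the-exponent; paper proof NODE-g51.md §3.4; NOT proved here, NOT print): **CONJUGATE POLES, `2` SPLIT,
`q` DEFINITE** (`¬ TwoAdicBounded q`: `q` has a root in `ℚ₂`; and no real root: `ℚ(√disc q)` imaginary quadratic with
`2 = 𝔭𝔭̄`).  [By Alvanos–Bilu–Poulakis 2009 Thm 1.1 (arXiv:0907.2097) this is the only definite case with infinitely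
many `ℤ[1/2]`-points.]  Paper proof (NODE-g51.md §3.4): the norm-form equation `v² q(u/v) = ±λ·2^e` pins
the point to `u + τv ∈ λ'·π^i π̄^j` with `i + j = e`, definiteness pins `|u + τv|² ≍ 2^e`, the valuation count pins
`e = N!/a + O(1)` and `min(i, j) = O(1)`, leaving finitely many candidates per level; the exact equation with
`p_N ≡ 1 (mod 2^{N! − (N−1)!})` then reads `η^{2N!} ≡ κ (mod 𝔭^{N!/a − O(1)})` for a FIXED `𝔭`-unit `η = π̄` and a
constant `κ`, so `κ = 1` and `v_𝔭(η^{2N!} − 1) = v_𝔭(η² − 1) + v₂(N!) = O(N)` (LTE) contradicts `≥ N!/a − O(1)`. -/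
def NormShapeLFSplitImag : Prop :=
  ∀ (g q : ℤ[X]) (a : ℕ) (D : ℤ), NormShapeHyp g q a D → ¬ TwoAdicBounded q →
    (∀ y : ℝ, aeval y q ≠ 0) → (NormShapeLevels g q a D).Finite

/-- [hypothesis] definition — residual class, FACT-NEEDED: ⟸ «`p`-adic linear forms in (three) logarithms»
(sources: ShoreyTijdeman1986 Thm B.3 p.38 (van der Poorten 1977); K. Yu, *Linear forms in p-adic logarithms* I–III
(1989–94); cite-kind ledger item wi-102310) via the `S`-unit parametrisation written out in NODE-g51.md §3.5 — NOT in the tree, NOT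
proved here: **CONJUGATE POLES, `2` SPLIT, `q` INDEFINITE** (`¬ TwoAdicBounded q`: `q` has a root in `ℚ₂`; AND a real
root: `ℚ(√disc q)` real quadratic with `2` split — the family `q = t² − 17`, g47's residual (δ)).  Why the elementary argument stops (NODE-g51.md §3.5): with the fundamental unit `ε` the candidates are
`u + τv = ±λ' ε^n π^i π̄^j`, boundedness of `x` pins `n` to `c·N! + O(1)` and the exact equation becomes
`ε^{n} π̄^{i} ≡ κ (mod 𝔭̄^{N!/a − O(1)})` with TWO independent `𝔭̄`-units and both exponents `≍ N!`: the product-formula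
(Liouville) bound `v(ε^n π̄^i − κ) ≤ O(n + i)` is exactly critical, and the `o(B)` bound `O((log B)²)` for the
`𝔭̄`-adic linear form in the three logarithms of `ε`, `π̄`, `κ` (van der Poorten / Yu) closes it. -/
def NormShapeLFSplitReal : Prop :=
  ∀ (g q : ℤ[X]) (a : ℕ) (D : ℤ), NormShapeHyp g q a D → ¬ TwoAdicBounded q →
    (∃ y : ℝ, aeval y q = 0) → (NormShapeLevels g q a D).Finite

/-- The three arithmetic grades of the conjugate-poles shape exhaust it. -/
theorem normShapeLevels_finite_of_grades (h₁ : NormShapeLFNonsplit) (h₂ : NormShapeLFSplitImag)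
    (h₃ : NormShapeLFSplitReal) (g q : ℤ[X]) (a : ℕ) (D : ℤ) (hH : NormShapeHyp g q a D) :
    (NormShapeLevels g q a D).Finite := by
  by_cases hs : TwoAdicBounded q
  · exact h₁ g q a D hH hs
  · by_cases hr : ∃ y : ℝ, aeval y q = 0
    · exact h₃ g q a D hH hs hr
    · push Not at hr
      exact h₂ g q a D hH hs hr

/-! ## §3  THE ONE-POLE SHAPE — PROVED from the tree's node 2 (`levels_finite`, Ridout by tree name) -/

/-- Values of a non-constant integer polynomial are large outside a bounded interval. -/
theorem exists_bound_of_abs_aeval_le (f : ℤ[X]) (hf : 1 ≤ f.natDegree) (M : ℝ) :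
    ∃ C : ℝ, ∀ t : ℝ, |aeval t f| ≤ M → |t| ≤ C := by
  set P : ℝ[X] := f.map (Int.castRingHom ℝ) with hP
  have hdeg : 0 < P.degree := by
    rw [hP, degree_map_eq_of_injective Int.cast_injective]
    exact natDegree_pos_iff_degree_pos.mp hf
  have hev : ∀ t : ℝ, aeval t f = eval t P := by
    intro t
    rw [hP, eval_map, aeval_def, algebraMap_int_eq]
  obtain ⟨a, ha⟩ := Filter.tendsto_atTop_atTop.1 (P.abs_tendsto_atTop hdeg) (M + 1)
  obtain ⟨b, hb⟩ := Filter.tendsto_atBot_atTop.1 (P.abs_tendsto_atBot hdeg) (M + 1)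
  refine ⟨max |a| |b|, fun t ht => ?_⟩
  rw [hev] at ht
  have h1 : t < a := by
    by_contra h
    have := ha t (not_lt.mp h)
    linarith
  have h2 : b < t := by
    by_contra h
    have := hb t (not_lt.mp h)
    linarith
  rw [abs_le]
  constructor
  · have : -t ≤ |b| := by have := neg_abs_le b; linarith
    linarith [le_max_right |a| |b|]
  · linarith [le_abs_self a, le_max_left |a| |b|]

/-- **THE ONE-POLE SHAPE — PROVED (hypothesis-free; Ridout via the tree's `levels_finite`).**  For `f ∈ ℤ[t]` of
degree `≥ 2` and `D ≠ 0`, only finitely many truncations `s_N` satisfy `f(t) = D·s_N` with `t ∈ ℚ`: the auxiliary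
`x`-linear curve `f(Y) = D·x` has pole gap `deg f ≥ 2` and no common root, so the tree's node-2 theorem applies once
the parameter is bounded (`exists_bound_of_abs_aeval_le`). -/
theorem polyShapeLF (f : ℤ[X]) (hf : 2 ≤ f.natDegree) (D : ℤ) (hD : D ≠ 0) :
    {N : ℕ | ∃ t : ℚ, aeval t f = D * sQ N}.Finite := by
  obtain ⟨C₀, hC₀⟩ := exists_bound_of_abs_aeval_le f (by omega) (2 * |(D : ℝ)|)
  set B : ℤ[X] := Polynomial.C (-D) with hB_def
  have hB : B ≠ 0 := by
    rw [hB_def, Ne, Polynomial.C_eq_zero, neg_eq_zero]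
    exact hD
  have hBdeg : B.natDegree = 0 := by rw [hB_def]; exact natDegree_C _
  have he : B.natDegree + 2 ≤ f.natDegree := by rw [hBdeg]; exact hf
  have hAB : ∀ r : ℚ, aeval r f = 0 → aeval r B = 0 → False := by
    intro r _ h
    rw [hB_def, aeval_C] at h
    simp only [algebraMap_int_eq, map_neg, eq_intCast, neg_eq_zero, Int.cast_eq_zero] at h
    exact hD h
  refine (levels_finite f B hB he hAB C₀).subset ?_
  rintro N ⟨t, ht⟩
  have e1 : aeval (t : ℝ) f = ((aeval t f : ℚ) : ℝ) := (aeval_ratCast f t).symm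
  refine ⟨t, ?_, ?_⟩
  · apply hC₀
    rw [e1, ht]
    push_cast
    rw [abs_mul]
    have h2 : |((sQ N : ℚ) : ℝ)| ≤ 2 := by exact_mod_cast abs_sQ_le N
    nlinarith [abs_nonneg (D : ℝ), abs_nonneg ((sQ N : ℚ) : ℝ)]
  · rw [bev_xLinP, e1, ht, hB_def, aeval_C, ← sQ_cast]
    simp only [algebraMap_int_eq, map_neg, eq_intCast]
    push_cast
    ring

end Summit.Schanuel.Schanuel.Theorems.RootDecomp1KLevelFinite

end
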